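import Literature.AlgebraicGeometry.ComplexMultiplication.CyclotomicFermatCMTypesLevelPullback
import Literature.AlgebraicGeometry.ComplexMultiplication.CyclotomicFermatCMTypesTwoPowerLevelIsogenies
import HarnessLib

/-!
# Koblitz–Rohrlich, THEOREM 4 (`N = 2ⁿ`), families d) and e): the coincidences
# `H_{(2ᵐ, 3·2ᵐ, 2ⁿ−2ᵐ⁺²)} = H_{(2ⁿ⁻¹−2ᵐ, 2ⁿ⁻¹−2ᵐ⁺¹, 3·2ᵐ)}` and `H_{(2ᵐ, 2ⁿ⁻¹, 2ⁿ⁻¹−2ᵐ)} = H_{(2ᵐ, 2ᵐ, 2ⁿ−2ᵐ⁺¹)}` for EVERY `n`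

Layer `Literature/AlgebraicGeometry/ComplexMultiplication`, namespace `…ComplexMultiplication.CyclotomicFermatCMType`; sequel of
`CyclotomicFermatCMTypesTwoPowerLevelIsogenies` (the members of Theorem 4's families at `N = 8, 16, 32` by kernel enumeration),
`CyclotomicFermatCMTypesThreePowerLevelCoincidences` (the same method for Theorem 3) and `CyclotomicFermatCMTypesLevelPullback` (change of
level).  THEOREMS ONLY (no definition, no named fact, no `sorry`); no kernel `decide` except two finite checks in `ZMod 4`.

THE SOURCE.  N. Koblitz, D. Rohrlich, *Simple factors in the Jacobian of a Fermat curve*, Canad. J. Math. **30** (1978) 1183–1205, p. 1186: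
"THEOREM 4. Suppose `N = 2ⁿ`. Then the only isogenies apart from the obvious ones are between pairs of lattices corresponding to the triples
a) … b) … c) … d) `(2ᵐ, 3(2ᵐ), 2ⁿ − 2ᵐ⁺²)` and `(2ⁿ⁻¹ − 2ᵐ, 2ⁿ⁻¹ − 2ᵐ⁺¹, 3(2ᵐ))` for `0 ≤ m ≤ n − 4`, or e) `(2ᵐ, 2ⁿ⁻¹, 2ⁿ⁻¹ − 2ᵐ)` and
`(2ᵐ, 2ᵐ, 2ⁿ − 2ᵐ⁺¹)` for `0 ≤ m ≤ n − 2`."  (§5, pp. 1201–1205, proves the theorem; `H_{r,s,t} = {h : ⟨hr⟩ + ⟨hs⟩ + ⟨ht⟩ = N}`, §1 p. 1184;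
"obvious" = a unit multiple of a permutation, p. 1185.)

WHAT IS PROVED — the EXISTENCE of the coincidences d) and e) at every level `2ⁿ`, and that they are not obvious.  With `T = 2ⁿ⁻¹`, `N = 2T`,
for every odd `x < N` the residues satisfy (§1) `T + ⟨(T−1)x⟩ = x + ⟨(N−2)x⟩` (two cases `x <> T`; family e), since `⟨Tx⟩ = T`) and, when
`4 ∣ T`, `x + ⟨(N−4)x⟩ = ⟨(T−1)x⟩ + ⟨(T−2)x⟩` (four cases `2x` against `T, 2T, 3T`; family d), the term `⟨3x⟩` being common); hence (§2–§3)
**`fermatCMType_twoPow_e_eq`** (`n ≥ 2`: `H_{(1, 2ⁿ⁻¹, 2ⁿ⁻¹−1)} = H_{(1, 1, 2ⁿ−2)}`) and **`fermatCMType_twoPow_d_eq`** (`n ≥ 4`: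
`H_{(2ⁿ⁻¹−1, 2ⁿ⁻¹−2, 3)} = H_{(1, 3, 2ⁿ−4)}`); the pairs with `m ≥ 1` are the pull-backs from level `2^{n−m}` (§4, the sibling's
`fermatCMType_level_mul_eq_of_eq`); §5: for `n ≥ 3` resp. `n ≥ 4` the two coincidences are NOT obvious (reduction modulo `4`:
`(1, 0, 3)` vs `(ū, ū, 2ū)`, and `(3, 2, 3)` vs `(ū, 3ū, 0)`).  Families a), c) are not treated: as transcribed their members are unit
multiples of each other (the sibling's honest column: c)₀ `(2,7,7) = 7·(1,1,14)`, and a)₀ `(2,3,11) = 3·(1,6,9)` modulo `16`); b) is illegible.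

## Honest column / NOT here

* Only the existence half for d), e); "the only isogenies" (§5 of the paper) is NOT typed beyond the sibling's complete lists at `8`, `16`.
* The residue identities are ours (K–R's §5 argues differently); the `m ≥ 1` statements live at the level written `2ᵐ·2^{n−m}`.
* As in the siblings, "isogeny of lattices" is equality of residue sets `H_τ`; Jacobian factors are not constructed.

## References

* [KoblitzRohrlich1978] N. Koblitz, D. Rohrlich, Canad. J. Math. 30 (1978) 1183–1205: Theorem 4 d), e) (p. 1186), §1 (pp. 1184–1185), §5.

## Provenance

Cell `pub-hodgecm2` (COR-CM), literature seat `lit-deligne-3` gen 36 (claim KR78-THM4-DE-ALL-N; count-neutral, own lane).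
-/

open NumberField

namespace Literature.AlgebraicGeometry.ComplexMultiplication

open Literature.AlgebraicGeometry.HodgeTheory

namespace CyclotomicFermatCMType

/-! ## §1 The residue identities modulo `2T` for odd `x` -/

section Residues

/-- `y % m = r` from `r + m·q = y`, `r < m` (private copy). [folklore] -/
private theorem mod_eq_of_add_mul_eq₂ {m r q y : ℕ} (hm : 0 < m) (h : r + m * q = y) (hr : r < m) : y % m = r :=
  ((Nat.div_mod_unique hm).2 ⟨h, hr⟩).2

/-- `(b·n + r) % n = r % n` (private copy). [folklore] -/
private theorem mul_add_mod_right₂ (b n r : ℕ) : (b * n + r) % n = r % n := by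
  rw [Nat.add_comm, Nat.add_mul_mod_self_right]

/-- `⟨Tx⟩ = T` modulo `2T` for odd `x` (`T ≥ 1`). [cite: KoblitzRohrlich1978, Theorem 4 e) (p. 1186)] -/
theorem mul_mod_two_mul_of_odd {T x : ℕ} (hT : 0 < T) (hx2 : x % 2 = 1) : (x * T) % (2 * T) = T := by
  set a := x / 2 with ha
  have hxe : x = 2 * a + 1 := by omega
  have e : x * T = a * (2 * T) + T := by
    rw [hxe]
    ring
  rw [e, mul_add_mod_right₂]
  exact Nat.mod_eq_of_lt (by omega)

/-- **The identity behind family e)**: for `T` even and odd `x < 2T`, `T + (x(T − 1) mod 2T) = x + (x(2T − 2) mod 2T)` (both sides are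
`2T − x` for `x < T` and `4T − x` for `x > T`). [cite: KoblitzRohrlich1978, Theorem 4 e) (p. 1186)] -/
theorem add_mul_mod_eq_family_e {T x : ℕ} (hT : 2 ∣ T) (hT0 : 0 < T) (hx2 : x % 2 = 1) (hx : x < 2 * T) :
    T + (x * (T - 1)) % (2 * T) = x + (x * (2 * T - 2)) % (2 * T) := by
  obtain ⟨T', hT'⟩ := hT
  have hpos : 0 < 2 * T := by omega
  set a := x / 2 with ha
  have hxe : x = 2 * a + 1 := by omega
  have hxT : x ≠ T := by omega
  have e1 : x * (T - 1) + x = a * (2 * T) + T := by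
    have h' : x * (T - 1) + x = x * (T - 1 + 1) := by ring
    rw [h', show T - 1 + 1 = T by omega, hxe]
    ring
  have e2 : x * (2 * T - 2) + 2 * x = x * (2 * T) := by
    have h' : x * (2 * T - 2) + 2 * x = x * (2 * T - 2 + 2) := by ring
    rw [h', show 2 * T - 2 + 2 = 2 * T by omega]
  rcases Nat.lt_or_ge x T with h1 | h1
  · -- `x < T`
    have f1 : (x - 1) * (2 * T) + 1 * (2 * T) = x * (2 * T) := by
      rw [← Nat.add_mul, Nat.sub_add_cancel (by omega : 1 ≤ x)]
    have mB : (x * (T - 1)) % (2 * T) = T - x := by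
      rw [show x * (T - 1) = a * (2 * T) + (T - x) by omega, mul_add_mod_right₂]
      exact Nat.mod_eq_of_lt (by omega)
    have mC : (x * (2 * T - 2)) % (2 * T) = 2 * T - 2 * x := by
      rw [show x * (2 * T - 2) = (x - 1) * (2 * T) + (2 * T - 2 * x) by omega, mul_add_mod_right₂]
      exact Nat.mod_eq_of_lt (by omega)
    rw [mB, mC]
    omega
  · -- `T < x < 2T`
    have ha1 : 1 ≤ a := by omega
    have g1 : (a - 1) * (2 * T) + 2 * T = a * (2 * T) := by
      obtain ⟨a', ha'⟩ : ∃ a', a = a' + 1 := ⟨a - 1, by omega⟩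
      rw [ha', show a' + 1 - 1 = a' by omega]
      ring
    have f2 : (x - 2) * (2 * T) + 2 * (2 * T) = x * (2 * T) := by
      rw [← Nat.add_mul, Nat.sub_add_cancel (by omega : 2 ≤ x)]
    have mB : (x * (T - 1)) % (2 * T) = 3 * T - x := by
      rw [show x * (T - 1) = (a - 1) * (2 * T) + (3 * T - x) by omega, mul_add_mod_right₂]
      exact Nat.mod_eq_of_lt (by omega)
    have mC : (x * (2 * T - 2)) % (2 * T) = 4 * T - 2 * x := by
      rw [show x * (2 * T - 2) = (x - 2) * (2 * T) + (4 * T - 2 * x) by omega, mul_add_mod_right₂]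
      exact Nat.mod_eq_of_lt (by omega)
    rw [mB, mC]
    omega

/-- **The identity behind family d)**: for `4 ∣ T` and odd `x < 2T`, `x + (x(2T − 4) mod 2T) = (x(T − 1) mod 2T) + (x(T − 2) mod 2T)`
(both sides are `2T − 3x`, `4T − 3x`, `6T − 3x`, `8T − 3x` according as `2x` lies below `T`, between `T` and `2T`, between `2T` and `3T`,
above `3T`). [cite: KoblitzRohrlich1978, Theorem 4 d) (p. 1186)] -/
theorem add_mul_mod_eq_family_d {T x : ℕ} (hT : 4 ∣ T) (hT0 : 0 < T) (hx2 : x % 2 = 1) (hx : x < 2 * T) :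
    x + (x * (2 * T - 4)) % (2 * T) = (x * (T - 1)) % (2 * T) + (x * (T - 2)) % (2 * T) := by
  obtain ⟨T', hT'⟩ := hT
  have hpos : 0 < 2 * T := by omega
  set a := x / 2 with ha
  have hxe : x = 2 * a + 1 := by omega
  -- `x ≠ T`, `2x ≠ T, 3T` (parity)
  have hxT : x ≠ T := by omega
  have h2xT : 2 * x ≠ T := by omega
  have h2x3T : 2 * x ≠ 3 * T := by omega
  have e1 : x * (T - 1) + x = a * (2 * T) + T := by
    have h' : x * (T - 1) + x = x * (T - 1 + 1) := by ring
    rw [h', show T - 1 + 1 = T by omega, hxe]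
    ring
  have e2 : x * (T - 2) + 2 * x = a * (2 * T) + T := by
    have h' : x * (T - 2) + 2 * x = x * (T - 2 + 2) := by ring
    rw [h', show T - 2 + 2 = T by omega, hxe]
    ring
  have e4 : x * (2 * T - 4) + 4 * x = x * (2 * T) := by
    have h' : x * (2 * T - 4) + 4 * x = x * (2 * T - 4 + 4) := by ring
    rw [h', show 2 * T - 4 + 4 = 2 * T by omega]
  -- quotient bookkeeping
  have fk : ∀ k : ℕ, k ≤ x → (x - k) * (2 * T) + k * (2 * T) = x * (2 * T) := fun k hk => by
    rw [← Nat.add_mul, Nat.sub_add_cancel hk]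
  have g1 : 1 ≤ a → (a - 1) * (2 * T) + 2 * T = a * (2 * T) := fun ha1 => by
    obtain ⟨a', ha'⟩ : ∃ a', a = a' + 1 := ⟨a - 1, by omega⟩
    rw [ha', show a' + 1 - 1 = a' by omega]
    ring
  have g2 : 2 ≤ a → (a - 2) * (2 * T) + 2 * (2 * T) = a * (2 * T) := fun ha2 => by
    obtain ⟨a', ha'⟩ : ∃ a', a = a' + 2 := ⟨a - 2, by omega⟩
    rw [ha', show a' + 2 - 2 = a' by omega]
    ring
  rcases Nat.lt_or_ge (2 * x) T with h1 | h1
  · -- `2x < T`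
    have f := fk 1 (by omega)
    have mA : (x * (2 * T - 4)) % (2 * T) = 2 * T - 4 * x := by
      rw [show x * (2 * T - 4) = (x - 1) * (2 * T) + (2 * T - 4 * x) by omega, mul_add_mod_right₂]
      exact Nat.mod_eq_of_lt (by omega)
    have mB : (x * (T - 1)) % (2 * T) = T - x := by
      rw [show x * (T - 1) = a * (2 * T) + (T - x) by omega, mul_add_mod_right₂]
      exact Nat.mod_eq_of_lt (by omega)
    have mC : (x * (T - 2)) % (2 * T) = T - 2 * x := by
      rw [show x * (T - 2) = a * (2 * T) + (T - 2 * x) by omega, mul_add_mod_right₂]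
      exact Nat.mod_eq_of_lt (by omega)
    rw [mA, mB, mC]
    omega
  · rcases Nat.lt_or_ge x T with h2 | h2
    · -- `T < 2x < 2T`
      have f := fk 2 (by omega)
      have g := g1 (by omega)
      have mA : (x * (2 * T - 4)) % (2 * T) = 4 * T - 4 * x := by
        rw [show x * (2 * T - 4) = (x - 2) * (2 * T) + (4 * T - 4 * x) by omega, mul_add_mod_right₂]
        exact Nat.mod_eq_of_lt (by omega)
      have mB : (x * (T - 1)) % (2 * T) = T - x := by
        rw [show x * (T - 1) = a * (2 * T) + (T - x) by omega, mul_add_mod_right₂]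
        exact Nat.mod_eq_of_lt (by omega)
      have mC : (x * (T - 2)) % (2 * T) = 3 * T - 2 * x := by
        rw [show x * (T - 2) = (a - 1) * (2 * T) + (3 * T - 2 * x) by omega, mul_add_mod_right₂]
        exact Nat.mod_eq_of_lt (by omega)
      rw [mA, mB, mC]
      omega
    · rcases Nat.lt_or_ge (2 * x) (3 * T) with h3 | h3
      · -- `2T < 2x < 3T`
        have f := fk 3 (by omega)
        have g := g1 (by omega)
        have mA : (x * (2 * T - 4)) % (2 * T) = 6 * T - 4 * x := by
          rw [show x * (2 * T - 4) = (x - 3) * (2 * T) + (6 * T - 4 * x) by omega, mul_add_mod_right₂]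
          exact Nat.mod_eq_of_lt (by omega)
        have mB : (x * (T - 1)) % (2 * T) = 3 * T - x := by
          rw [show x * (T - 1) = (a - 1) * (2 * T) + (3 * T - x) by omega, mul_add_mod_right₂]
          exact Nat.mod_eq_of_lt (by omega)
        have mC : (x * (T - 2)) % (2 * T) = 3 * T - 2 * x := by
          rw [show x * (T - 2) = (a - 1) * (2 * T) + (3 * T - 2 * x) by omega, mul_add_mod_right₂]
          exact Nat.mod_eq_of_lt (by omega)
        rw [mA, mB, mC]
        omega
      · -- `3T < 2x < 4T`
        have f := fk 4 (by omega)
        have g := g1 (by omega)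
        have g' := g2 (by omega)
        have mA : (x * (2 * T - 4)) % (2 * T) = 8 * T - 4 * x := by
          rw [show x * (2 * T - 4) = (x - 4) * (2 * T) + (8 * T - 4 * x) by omega, mul_add_mod_right₂]
          exact Nat.mod_eq_of_lt (by omega)
        have mB : (x * (T - 1)) % (2 * T) = 3 * T - x := by
          rw [show x * (T - 1) = (a - 1) * (2 * T) + (3 * T - x) by omega, mul_add_mod_right₂]
          exact Nat.mod_eq_of_lt (by omega)
        have mC : (x * (T - 2)) % (2 * T) = 5 * T - 2 * x := by
          rw [show x * (T - 2) = (a - 2) * (2 * T) + (5 * T - 2 * x) by omega, mul_add_mod_right₂]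
          exact Nat.mod_eq_of_lt (by omega)
        rw [mA, mB, mC]
        omega

end Residues

/-! ## §2 The residues of the four triples at level `2ⁿ` -/

section Level

variable {n : ℕ}

/-- A unit modulo `2ⁿ` (`n ≥ 1`) has odd `val`. [folklore] -/
private theorem val_mod_two_of_coprime (hn : 1 ≤ n) {x : ZMod (2 ^ n)} (hx : x.val.Coprime (2 ^ n)) : x.val % 2 = 1 := by
  by_contra h0
  have h2 : 2 ∣ Nat.gcd x.val (2 ^ n) := Nat.dvd_gcd (Nat.dvd_of_mod_eq_zero (by omega)) (dvd_pow_self 2 (by omega))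
  rw [hx] at h2
  exact absurd (Nat.le_of_dvd one_pos h2) (by norm_num)

/-- **Family e) at `m = 0`, the residues**: for `n ≥ 2` and every unit `x` modulo `2ⁿ`,
`⟨x⟩ + ⟨2ⁿ⁻¹x⟩ + ⟨(2ⁿ⁻¹ − 1)x⟩ = ⟨x⟩ + ⟨x⟩ + ⟨(2ⁿ − 2)x⟩`. [cite: KoblitzRohrlich1978, Theorem 4 e) (p. 1186)] -/
theorem val_sum_eq_family_e [NeZero (2 ^ n)] (hn : 2 ≤ n) (x : ZMod (2 ^ n)) (hx : x.val.Coprime (2 ^ n)) :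
    (x * 1).val + (x * ((2 ^ (n - 1) : ℕ) : ZMod (2 ^ n))).val + (x * ((2 ^ (n - 1) - 1 : ℕ) : ZMod (2 ^ n))).val =
      (x * 1).val + (x * 1).val + (x * ((2 ^ n - 2 : ℕ) : ZMod (2 ^ n))).val := by
  set T := 2 ^ (n - 1) with hT
  have hN : 2 ^ n = 2 * T := by
    rw [hT, ← pow_succ']
    congr 1
    omega
  have hT2 : 2 ≤ T := by
    rw [hT]
    calc 2 = 2 ^ 1 := (pow_one 2).symm
      _ ≤ 2 ^ (n - 1) := Nat.pow_le_pow_right (by norm_num) (by omega)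
  have hTdvd : 2 ∣ T := by
    rw [hT]
    exact dvd_pow_self 2 (by omega)
  have hodd := val_mod_two_of_coprime (by omega) hx
  have hlt1 : T < 2 ^ n := by omega
  have hlt2 : T - 1 < 2 ^ n := by omega
  have hlt3 : 2 ^ n - 2 < 2 ^ n := by omega
  have hxlt : x.val < 2 ^ n := ZMod.val_lt x
  simp only [mul_one, ZMod.val_mul, ZMod.val_natCast, Nat.mod_eq_of_lt hlt1, Nat.mod_eq_of_lt hlt2, Nat.mod_eq_of_lt hlt3]
  set X := x.val with hX
  rw [hN] at hxlt ⊢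
  rw [mul_mod_two_mul_of_odd (by omega) hodd]
  have key := add_mul_mod_eq_family_e hTdvd (by omega) hodd hxlt
  omega

/-- **Family d) at `m = 0`, the residues**: for `n ≥ 4` and every unit `x` modulo `2ⁿ`,
`⟨(2ⁿ⁻¹ − 1)x⟩ + ⟨(2ⁿ⁻¹ − 2)x⟩ + ⟨3x⟩ = ⟨x⟩ + ⟨3x⟩ + ⟨(2ⁿ − 4)x⟩`. [cite: KoblitzRohrlich1978, Theorem 4 d) (p. 1186)] -/
theorem val_sum_eq_family_d [NeZero (2 ^ n)] (hn : 4 ≤ n) (x : ZMod (2 ^ n)) (hx : x.val.Coprime (2 ^ n)) :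
    (x * ((2 ^ (n - 1) - 1 : ℕ) : ZMod (2 ^ n))).val + (x * ((2 ^ (n - 1) - 2 : ℕ) : ZMod (2 ^ n))).val + (x * 3).val =
      (x * 1).val + (x * 3).val + (x * ((2 ^ n - 4 : ℕ) : ZMod (2 ^ n))).val := by
  set T := 2 ^ (n - 1) with hT
  have hN : 2 ^ n = 2 * T := by
    rw [hT, ← pow_succ']
    congr 1
    omega
  have hT8 : 8 ≤ T := by
    rw [hT]
    calc 8 = 2 ^ 3 := by norm_num
      _ ≤ 2 ^ (n - 1) := Nat.pow_le_pow_right (by norm_num) (by omega)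
  have hTdvd : 4 ∣ T := by
    rw [hT, show n - 1 = 2 + (n - 3) by omega, pow_add]
    exact dvd_mul_right 4 _
  have hodd := val_mod_two_of_coprime (by omega) hx
  have hlt1 : T - 1 < 2 ^ n := by omega
  have hlt2 : T - 2 < 2 ^ n := by omega
  have hlt3 : 2 ^ n - 4 < 2 ^ n := by omega
  have hxlt : x.val < 2 ^ n := ZMod.val_lt x
  simp only [mul_one, ZMod.val_mul, ZMod.val_natCast, Nat.mod_eq_of_lt hlt1, Nat.mod_eq_of_lt hlt2, Nat.mod_eq_of_lt hlt3]
  set X := x.val with hX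
  rw [hN] at hxlt ⊢
  have key := add_mul_mod_eq_family_d hTdvd (by omega) hodd hxlt
  omega

end Level

/-! ## §3 THEOREM 4 d) and e), existence half at `m = 0`, every `n` -/

section TheoremFour

variable {n : ℕ}

/-- **THEOREM 4 e) at `m = 0`, EVERY `n ≥ 2`**: `H_{(1, 2ⁿ⁻¹, 2ⁿ⁻¹ − 1)} = H_{(1, 1, 2ⁿ − 2)}` as residue sets modulo `2ⁿ` — the
lattices `L_{(1, 2ⁿ⁻¹, 2ⁿ⁻¹−1)}` and `L_{(1, 1, 2ⁿ−2)}` coincide. [cite: KoblitzRohrlich1978, Theorem 4 e) (p. 1186) and §1 (p. 1184)] -/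
theorem fermatCMType_twoPow_e_eq [NeZero (2 ^ n)] (hn : 2 ≤ n) :
    fermatCMType (2 ^ n) 1 ((2 ^ (n - 1) : ℕ) : ZMod (2 ^ n)) ((2 ^ (n - 1) - 1 : ℕ) : ZMod (2 ^ n)) =
      fermatCMType (2 ^ n) 1 1 ((2 ^ n - 2 : ℕ) : ZMod (2 ^ n)) := by
  ext x
  simp only [fermatCMType, Finset.mem_filter, Finset.mem_univ, true_and]
  constructor
  · rintro ⟨hc, hs⟩
    exact ⟨hc, by rw [← val_sum_eq_family_e hn x hc]; exact hs⟩
  · rintro ⟨hc, hs⟩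
    exact ⟨hc, by rw [val_sum_eq_family_e hn x hc]; exact hs⟩

/-- **THEOREM 4 d) at `m = 0`, EVERY `n ≥ 4`**: `H_{(2ⁿ⁻¹ − 1, 2ⁿ⁻¹ − 2, 3)} = H_{(1, 3, 2ⁿ − 4)}` as residue sets modulo `2ⁿ`.
[cite: KoblitzRohrlich1978, Theorem 4 d) (p. 1186) and §1 (p. 1184)] -/
theorem fermatCMType_twoPow_d_eq [NeZero (2 ^ n)] (hn : 4 ≤ n) :
    fermatCMType (2 ^ n) ((2 ^ (n - 1) - 1 : ℕ) : ZMod (2 ^ n)) ((2 ^ (n - 1) - 2 : ℕ) : ZMod (2 ^ n)) 3 =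
      fermatCMType (2 ^ n) 1 3 ((2 ^ n - 4 : ℕ) : ZMod (2 ^ n)) := by
  ext x
  simp only [fermatCMType, Finset.mem_filter, Finset.mem_univ, true_and]
  constructor
  · rintro ⟨hc, hs⟩
    exact ⟨hc, by rw [← val_sum_eq_family_d hn x hc]; exact hs⟩
  · rintro ⟨hc, hs⟩
    exact ⟨hc, by rw [val_sum_eq_family_d hn x hc]; exact hs⟩

/-- **`N = 64`** (`n = 6`): e)₀ `H_{(1, 32, 31)} = H_{(1, 1, 62)}` and d)₀ `H_{(31, 30, 3)} = H_{(1, 3, 60)}` — beyond the sibling's kernel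
enumerations (`N ≤ 32`). [cite: KoblitzRohrlich1978, Theorem 4 d), e) (p. 1186)] -/
theorem fermatCMType_sixtyFour_e_d :
    fermatCMType 64 1 32 31 = fermatCMType 64 1 1 62 ∧ fermatCMType 64 31 30 3 = fermatCMType 64 1 3 60 := by
  have he := fermatCMType_twoPow_e_eq (n := 6) (by norm_num)
  have hd := fermatCMType_twoPow_d_eq (n := 6) (by norm_num)
  norm_num at he hd
  exact ⟨he, hd⟩

end TheoremFour

/-! ## §4 The pairs with `m ≥ 1`: pull-backs from level `2^{n−m}` -/

section Scaled

variable {n m : ℕ}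

/-- **THEOREM 4 e), EVERY `n` AND `0 ≤ m ≤ n − 2`** (level written `2ᵐ·2^{n−m} = 2ⁿ`; `(2ᵐ, 2ⁿ⁻¹, 2ⁿ⁻¹ − 2ᵐ) = 2ᵐ·(1, 2^{n−m−1},
2^{n−m−1} − 1)`, `(2ᵐ, 2ᵐ, 2ⁿ − 2ᵐ⁺¹) = 2ᵐ·(1, 1, 2^{n−m} − 2)`): the two residue sets coincide — the `m = 0` case pulled back along
`ℤ/2ⁿ → ℤ/2^{n−m}`. [cite: KoblitzRohrlich1978, Theorem 4 e) (p. 1186) and §1 (p. 1184)] -/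
theorem fermatCMType_twoPow_e_eq_scaled [NeZero (2 ^ (n - m))] [NeZero (2 ^ m * 2 ^ (n - m))] (hmn : m + 2 ≤ n) :
    fermatCMType (2 ^ m * 2 ^ (n - m)) ((2 ^ m * 1 : ℕ) : ZMod (2 ^ m * 2 ^ (n - m)))
        ((2 ^ m * 2 ^ (n - m - 1) : ℕ) : ZMod (2 ^ m * 2 ^ (n - m))) ((2 ^ m * (2 ^ (n - m - 1) - 1) : ℕ) : ZMod (2 ^ m * 2 ^ (n - m))) =
      fermatCMType (2 ^ m * 2 ^ (n - m)) ((2 ^ m * 1 : ℕ) : ZMod (2 ^ m * 2 ^ (n - m)))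
        ((2 ^ m * 1 : ℕ) : ZMod (2 ^ m * 2 ^ (n - m))) ((2 ^ m * (2 ^ (n - m) - 2) : ℕ) : ZMod (2 ^ m * 2 ^ (n - m))) := by
  have h := fermatCMType_twoPow_e_eq (n := n - m) (by omega)
  refine fermatCMType_level_mul_eq_of_eq (pow_pos (by norm_num : 0 < 2) m) ?_
  simpa only [Nat.cast_one] using h

/-- **THEOREM 4 d), EVERY `n` AND `0 ≤ m ≤ n − 4`** (level `2ᵐ·2^{n−m}`; `(2ᵐ, 3·2ᵐ, 2ⁿ − 2ᵐ⁺²) = 2ᵐ·(1, 3, 2^{n−m} − 4)`,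
`(2ⁿ⁻¹ − 2ᵐ, 2ⁿ⁻¹ − 2ᵐ⁺¹, 3·2ᵐ) = 2ᵐ·(2^{n−m−1} − 1, 2^{n−m−1} − 2, 3)`). [cite: KoblitzRohrlich1978, Theorem 4 d) (p. 1186) and §1 (p. 1184)] -/
theorem fermatCMType_twoPow_d_eq_scaled [NeZero (2 ^ (n - m))] [NeZero (2 ^ m * 2 ^ (n - m))] (hmn : m + 4 ≤ n) :
    fermatCMType (2 ^ m * 2 ^ (n - m)) ((2 ^ m * (2 ^ (n - m - 1) - 1) : ℕ) : ZMod (2 ^ m * 2 ^ (n - m)))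
        ((2 ^ m * (2 ^ (n - m - 1) - 2) : ℕ) : ZMod (2 ^ m * 2 ^ (n - m))) ((2 ^ m * 3 : ℕ) : ZMod (2 ^ m * 2 ^ (n - m))) =
      fermatCMType (2 ^ m * 2 ^ (n - m)) ((2 ^ m * 1 : ℕ) : ZMod (2 ^ m * 2 ^ (n - m)))
        ((2 ^ m * 3 : ℕ) : ZMod (2 ^ m * 2 ^ (n - m))) ((2 ^ m * (2 ^ (n - m) - 4) : ℕ) : ZMod (2 ^ m * 2 ^ (n - m))) := by
  have h := fermatCMType_twoPow_d_eq (n := n - m) (by omega)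
  refine fermatCMType_level_mul_eq_of_eq (pow_pos (by norm_num : 0 < 2) m) ?_
  simpa only [Nat.cast_one, Nat.cast_ofNat] using h

end Scaled

/-! ## §5 The coincidences d)₀ and e)₀ are not obvious -/

section NotObvious

variable {n : ℕ}

/-- Reduction modulo `4` of the entries (`n ≥ 3`): `2ⁿ⁻¹ ↦ 0`, `2ⁿ⁻¹ − 1 ↦ 3`, `2ⁿ⁻¹ − 2 ↦ 2`, `2ⁿ − 2 ↦ 2`, `2ⁿ − 4 ↦ 0`. [folklore] -/
private theorem castHom_four_entries (hn : 3 ≤ n) :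
    ZMod.castHom (show 4 ∣ 2 ^ n from by rw [show n = 2 + (n - 2) by omega, pow_add]; exact dvd_mul_right 4 _) (ZMod 4)
        ((2 ^ (n - 1) : ℕ) : ZMod (2 ^ n)) = 0 ∧
      ZMod.castHom (show 4 ∣ 2 ^ n from by rw [show n = 2 + (n - 2) by omega, pow_add]; exact dvd_mul_right 4 _) (ZMod 4)
        ((2 ^ (n - 1) - 1 : ℕ) : ZMod (2 ^ n)) = 3 ∧
      ZMod.castHom (show 4 ∣ 2 ^ n from by rw [show n = 2 + (n - 2) by omega, pow_add]; exact dvd_mul_right 4 _) (ZMod 4)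
        ((2 ^ (n - 1) - 2 : ℕ) : ZMod (2 ^ n)) = 2 ∧
      ZMod.castHom (show 4 ∣ 2 ^ n from by rw [show n = 2 + (n - 2) by omega, pow_add]; exact dvd_mul_right 4 _) (ZMod 4)
        ((2 ^ n - 2 : ℕ) : ZMod (2 ^ n)) = 2 ∧
      ZMod.castHom (show 4 ∣ 2 ^ n from by rw [show n = 2 + (n - 2) by omega, pow_add]; exact dvd_mul_right 4 _) (ZMod 4)
        ((2 ^ n - 4 : ℕ) : ZMod (2 ^ n)) = 0 := by
  have hT : 4 ∣ 2 ^ (n - 1) := by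
    rw [show n - 1 = 2 + (n - 3) by omega, pow_add]
    exact dvd_mul_right 4 _
  have hN : 4 ∣ 2 ^ n := by
    rw [show n = 2 + (n - 2) by omega, pow_add]
    exact dvd_mul_right 4 _
  have hT4 : 4 ≤ 2 ^ (n - 1) := Nat.le_of_dvd (pow_pos (by norm_num) _) hT
  have hN8 : 2 ^ (n - 1) < 2 ^ n := Nat.pow_lt_pow_right (by norm_num) (by omega)
  obtain ⟨T', hT'⟩ := hT
  obtain ⟨N', hN'⟩ := hN
  refine ⟨?_, ?_, ?_, ?_, ?_⟩
  · rw [map_natCast, ZMod.natCast_eq_zero_iff]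
    exact ⟨T', hT'⟩
  · rw [map_natCast, show (3 : ZMod 4) = ((3 : ℕ) : ZMod 4) from (Nat.cast_ofNat).symm, ZMod.natCast_eq_natCast_iff']
    omega
  · rw [map_natCast, show (2 : ZMod 4) = ((2 : ℕ) : ZMod 4) from (Nat.cast_ofNat).symm, ZMod.natCast_eq_natCast_iff']
    omega
  · rw [map_natCast, show (2 : ZMod 4) = ((2 : ℕ) : ZMod 4) from (Nat.cast_ofNat).symm, ZMod.natCast_eq_natCast_iff']
    omega
  · rw [map_natCast, ZMod.natCast_eq_zero_iff]
    exact ⟨N' - 1, by omega⟩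

/-- **e)₀ is NOT obvious, every `n ≥ 3`**: `(1, 2ⁿ⁻¹, 2ⁿ⁻¹ − 1)` is no multiple `u·(1, 1, 2ⁿ − 2)` of a permutation modulo `2ⁿ`
(modulo `4`: `(1, 0, 3)` against `(ū, ū, 2ū)`). [cite: KoblitzRohrlich1978, Theorem 4 e) (p. 1186) and §1 (p. 1185)] -/
theorem not_exists_multiset_eq_twoPow_e (hn : 3 ≤ n) :
    ¬∃ u : ZMod (2 ^ n), ({1, ((2 ^ (n - 1) : ℕ) : ZMod (2 ^ n)), ((2 ^ (n - 1) - 1 : ℕ) : ZMod (2 ^ n))} : Multiset (ZMod (2 ^ n))) =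
      {u * 1, u * 1, u * ((2 ^ n - 2 : ℕ) : ZMod (2 ^ n))} := by
  rintro ⟨u, hu⟩
  obtain ⟨eT, eT1, -, eN2, -⟩ := castHom_four_entries hn
  set φ := ZMod.castHom (show 4 ∣ 2 ^ n from by rw [show n = 2 + (n - 2) by omega, pow_add]; exact dvd_mul_right 4 _) (ZMod 4)
    with hφ
  have h1 : (1 : ZMod (2 ^ n)) ∈ ({u * 1, u * 1, u * ((2 ^ n - 2 : ℕ) : ZMod (2 ^ n))} : Multiset (ZMod (2 ^ n))) := by
    rw [← hu]
    simp
  have h0 : ((2 ^ (n - 1) : ℕ) : ZMod (2 ^ n)) ∈ ({u * 1, u * 1, u * ((2 ^ n - 2 : ℕ) : ZMod (2 ^ n))} : Multiset (ZMod (2 ^ n))) := by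
    rw [← hu]
    simp
  simp only [Multiset.insert_eq_cons, Multiset.mem_cons, Multiset.mem_singleton] at h0 h1
  -- modulo `4`: `1 ∈ {ū, ū, 2ū}` forces `ū = 1`, and then `0 ∉ {1, 1, 2}`
  have hu1 : φ u = 1 ∨ φ u * 2 = 1 := by
    rcases h1 with e | e | e
    · left
      have h := congrArg φ e
      rw [map_one, map_mul, map_one, mul_one] at h
      exact h.symm
    · left
      have h := congrArg φ e
      rw [map_one, map_mul, map_one, mul_one] at h
      exact h.symm
    · right
      have h := congrArg φ e
      rw [map_one, map_mul, eN2] at h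
      exact h.symm
  have hu0 : φ u = 0 ∨ φ u * 2 = 0 := by
    rcases h0 with e | e | e
    · left
      have h := congrArg φ e
      rw [eT, map_mul, map_one, mul_one] at h
      exact h.symm
    · left
      have h := congrArg φ e
      rw [eT, map_mul, map_one, mul_one] at h
      exact h.symm
    · right
      have h := congrArg φ e
      rw [eT, map_mul, eN2] at h
      exact h.symm
  generalize φ u = v at hu1 hu0
  revert v
  decide

/-- **d)₀ is NOT obvious, every `n ≥ 4`**: `(2ⁿ⁻¹ − 1, 2ⁿ⁻¹ − 2, 3)` is no multiple `u·(1, 3, 2ⁿ − 4)` of a permutation modulo `2ⁿ`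
(modulo `4`: `(3, 2, 3)` contains no `0`, but `u·(2ⁿ − 4) ↦ 0`). [cite: KoblitzRohrlich1978, Theorem 4 d) (p. 1186) and §1 (p. 1185)] -/
theorem not_exists_multiset_eq_twoPow_d (hn : 4 ≤ n) :
    ¬∃ u : ZMod (2 ^ n), ({((2 ^ (n - 1) - 1 : ℕ) : ZMod (2 ^ n)), ((2 ^ (n - 1) - 2 : ℕ) : ZMod (2 ^ n)), 3} : Multiset (ZMod (2 ^ n))) =
      {u * 1, u * 3, u * ((2 ^ n - 4 : ℕ) : ZMod (2 ^ n))} := by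
  rintro ⟨u, hu⟩
  obtain ⟨-, eT1, eT2, -, eN4⟩ := castHom_four_entries (by omega : 3 ≤ n)
  set φ := ZMod.castHom (show 4 ∣ 2 ^ n from by rw [show n = 2 + (n - 2) by omega, pow_add]; exact dvd_mul_right 4 _) (ZMod 4)
    with hφ
  have h0 : u * ((2 ^ n - 4 : ℕ) : ZMod (2 ^ n)) ∈
      ({((2 ^ (n - 1) - 1 : ℕ) : ZMod (2 ^ n)), ((2 ^ (n - 1) - 2 : ℕ) : ZMod (2 ^ n)), 3} : Multiset (ZMod (2 ^ n))) := by
    rw [hu]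
    simp
  simp only [Multiset.insert_eq_cons, Multiset.mem_cons, Multiset.mem_singleton] at h0
  have hz : φ (u * ((2 ^ n - 4 : ℕ) : ZMod (2 ^ n))) = 0 := by rw [map_mul, eN4, mul_zero]
  rcases h0 with e | e | e
  · rw [e, eT1] at hz
    exact absurd hz (by decide)
  · rw [e, eT2] at hz
    exact absurd hz (by decide)
  · rw [e, show φ 3 = 3 from by rw [show (3 : ZMod (2 ^ n)) = ((3 : ℕ) : ZMod (2 ^ n)) from (Nat.cast_ofNat).symm, map_natCast,
      Nat.cast_ofNat]] at hz
    exact absurd hz (by decide)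

end NotObvious

end CyclotomicFermatCMType

end Literature.AlgebraicGeometry.ComplexMultiplication
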